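import Mathlib
import Summits.Ventures.PercRepro2.Defs
import Summits.Ventures.PercRepro2.Harris
import Summits.Ventures.PercRepro2.CoinDefs
import Summits.Ventures.PercRepro2.CoinInduced
import Summits.Ventures.PercRepro2.CoinLsmCoreDefs
import Summits.Ventures.PercRepro2.CoinOrTailKDefs
import Summits.Ventures.PercRepro2.CoinTreeCore
import Summits.Ventures.PercRepro2.CoinKSureTailSums
import Summits.Ventures.PercRepro2.CoinKSureTail
import Summits.Ventures.PercRepro2.CoinSubdivide
import Summits.Ventures.PercRepro2.CoinKSureSubOrTail
import Summits.Ventures.PercRepro2.CoinKSureSubLsm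

/-!
# Row 2′DARC at an OR-tail with a MARKER AT THE TAIL and ARBITRARY coins (blind cell
PercRepro2, night-2 g15; proofs/NIGHT2-DARC.md §52)

The sure-coin theorems of §51 (`darc_of_orTailKSure_tail*`) transfer to arbitrary entry coins
by SUBDIVISION (§52): subdividing every entry coin `r → a` by a sure arc gives an OR-tail of the
subdivided system with sure entries (`orTailK_sub`) on a log-supermodular core
(`subCore_lsm`), and row 2′DARC is invariant under the subdivision (`darc_sub_iff`).
`darc_of_orTailK_tail_coins` (markers `(a, m)`), `darc_of_orTailK_tail_coins'` (`(m, a)`),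
`darc_of_orTailK_tail₂_coins` (both markers at `a`) and the out-tree corollaries — no
spare-vertex hypothesis (the subdivision brings its own vertices).
-/

namespace Summit.Ventures.PercRepro2.Coin

open Classical

section TailCoins

variable {V : Type*} {E : Type*} [Fintype V] [DecidableEq V] [Fintype E] [DecidableEq E]
  {R : Type*} [Field R] [LinearOrder R] [IsStrictOrderedRing R]
  {arcs : E → Finset (V × V)} {s : V} {U : Finset V} {ent : Finset V} {c : V → E} {a w : V}

omit [Fintype V] in
/-- The data of the subdivided OR-tail needed by the sure-coin theorems, packaged. -/
lemma OrTailK.sub_data (pr : E → R) (hp : IsProbVec pr) (h : OrTailK arcs s U ent c a)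
    (hν : ∀ W W', W ⊆ U → W' ⊆ U →
      prob pr (coreLevel arcs s U W) * prob pr (coreLevel arcs s U W') ≤
        prob pr (coreLevel arcs s U (W ∩ W')) * prob pr (coreLevel arcs s U (W ∪ W')))
    {t : V} (htC : t ∉ insert a U) (hwC : w ∉ insert a U) :
    (∀ r ∈ (ent.image c).map Function.Embedding.inr,
        subPr pr ((Sum.elim (fun v => Sum.inl (c v)) (fun e => Sum.inr e) : V ⊕ E → E ⊕ E) r) = 1) ∧
    (∀ W W', W ⊆ subCore U (ent.image c) → W' ⊆ subCore U (ent.image c) →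
      prob (subPr pr) (coreLevel (subArcs arcs (ent.image c) (srcOf ent c s) (fun _ => a))
          (Sum.inl s) (subCore U (ent.image c)) W) *
        prob (subPr pr) (coreLevel (subArcs arcs (ent.image c) (srcOf ent c s) (fun _ => a))
          (Sum.inl s) (subCore U (ent.image c)) W') ≤
      prob (subPr pr) (coreLevel (subArcs arcs (ent.image c) (srcOf ent c s) (fun _ => a))
          (Sum.inl s) (subCore U (ent.image c)) (W ∩ W')) *
        prob (subPr pr) (coreLevel (subArcs arcs (ent.image c) (srcOf ent c s) (fun _ => a))
          (Sum.inl s) (subCore U (ent.image c)) (W ∪ W'))) ∧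
    Sum.inl t ∉ insert (Sum.inl a) (subCore U (ent.image c)) ∧
    Sum.inl w ∉ insert (Sum.inl a) (subCore U (ent.image c)) := by
  refine ⟨?_, ?_, ?_, ?_⟩
  · intro r hr
    obtain ⟨e, _, rfl⟩ := Finset.mem_map.1 hr
    rfl
  · intro W W' hW hW'
    have := subCore_lsm pr hp h hν (ent.image c) (Finset.Subset.refl _) W hW W' hW'
    simpa only [subLaw] using this
  · rw [Finset.mem_insert, inl_mem_subCore, not_or]
    rw [Finset.mem_insert, not_or] at htC
    exact ⟨fun e => htC.1 (Sum.inl_injective e), htC.2⟩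
  · rw [Finset.mem_insert, inl_mem_subCore, not_or]
    rw [Finset.mem_insert, not_or] at hwC
    exact ⟨fun e => hwC.1 (Sum.inl_injective e), hwC.2⟩

/-- **THEOREM (row 2′DARC at an OR-tail, ONE MARKER AT THE TAIL, ARBITRARY coins).**
`OrTailK arcs s U ent c a` with any entry set and any coin probabilities, `SameEnds`, the
cluster law of `U` log-supermodular, the markers `a` and `m ∈ U`, every head, every probability
vector: `DARC pr arcs s {t} a m a w`. -/
theorem darc_of_orTailK_tail_coins (pr : E → R) (hp : IsProbVec pr) (hS : SameEnds arcs)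
    (h : OrTailK arcs s U ent c a) {m : V} (hm : m ∈ U)
    (hν : ∀ W W', W ⊆ U → W' ⊆ U →
      prob pr (coreLevel arcs s U W) * prob pr (coreLevel arcs s U W') ≤
        prob pr (coreLevel arcs s U (W ∩ W')) * prob pr (coreLevel arcs s U (W ∪ W')))
    {t : V} (htC : t ∉ insert a U) (hts : t ≠ s) (hws : w ≠ s) (hwC : w ∉ insert a U) :
    DARC pr arcs s {t} a m a w := by
  obtain ⟨hsure', hν', htC', hwC'⟩ := h.sub_data (w := w) pr hp hν htC hwC
  have key := darc_of_orTailKSure_tail (subPr pr) (isProbVec_subPr hp) (sameEnds_sub hS)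
    (orTailK_sub h) ((inl_mem_subCore).2 hm) hsure' hν' htC'
    (fun e => hts (Sum.inl_injective e)) (fun e => hws (Sum.inl_injective e)) hwC'
  have hiff := darc_sub_iff h.arcs_entry pr s {t} a m a w
  rw [Finset.map_singleton] at hiff
  exact hiff.1 key

/-- **The mirror: markers `(m, a)`, arbitrary coins.** -/
theorem darc_of_orTailK_tail_coins' (pr : E → R) (hp : IsProbVec pr) (hS : SameEnds arcs)
    (h : OrTailK arcs s U ent c a) {m : V} (hm : m ∈ U)
    (hν : ∀ W W', W ⊆ U → W' ⊆ U →
      prob pr (coreLevel arcs s U W) * prob pr (coreLevel arcs s U W') ≤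
        prob pr (coreLevel arcs s U (W ∩ W')) * prob pr (coreLevel arcs s U (W ∪ W')))
    {t : V} (htC : t ∉ insert a U) (hts : t ≠ s) (hws : w ≠ s) (hwC : w ∉ insert a U) :
    DARC pr arcs s {t} m a a w :=
  (darc_swap pr arcs s {t} a m a w).1
    (darc_of_orTailK_tail_coins pr hp hS h hm hν htC hts hws hwC)

/-- **THEOREM (BOTH markers at the tail, arbitrary coins)**: `DARC pr arcs s {t} a a a w`. -/
theorem darc_of_orTailK_tail₂_coins (pr : E → R) (hp : IsProbVec pr) (hS : SameEnds arcs)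
    (h : OrTailK arcs s U ent c a)
    (hν : ∀ W W', W ⊆ U → W' ⊆ U →
      prob pr (coreLevel arcs s U W) * prob pr (coreLevel arcs s U W') ≤
        prob pr (coreLevel arcs s U (W ∩ W')) * prob pr (coreLevel arcs s U (W ∪ W')))
    {t : V} (htC : t ∉ insert a U) (hts : t ≠ s) (hws : w ≠ s) (hwC : w ∉ insert a U) :
    DARC pr arcs s {t} a a a w := by
  obtain ⟨hsure', hν', htC', hwC'⟩ := h.sub_data (w := w) pr hp hν htC hwC
  have key := darc_of_orTailKSure_tail₂ (subPr pr) (isProbVec_subPr hp) (sameEnds_sub hS)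
    (orTailK_sub h) hsure' hν' htC'
    (fun e => hts (Sum.inl_injective e)) (fun e => hws (Sum.inl_injective e)) hwC'
  have hiff := darc_sub_iff h.arcs_entry pr s {t} a a a w
  rw [Finset.map_singleton] at hiff
  exact hiff.1 key

/-- **COROLLARY (out-tree core): one marker at the tail, arbitrary coins.** -/
theorem darc_of_orTailTreeK_tail_coins (pr : E → R) (hp : IsProbVec pr) (hS : SameEnds arcs)
    (h : OrTailK arcs s U ent c a) {c' : V → E} {par : V → V} {rk : V → ℕ}
    (hT : TreeCore arcs s U c' par rk) {m : V} (hm : m ∈ U)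
    {t : V} (htC : t ∉ insert a U) (hts : t ≠ s) (hws : w ≠ s) (hwC : w ∉ insert a U) :
    DARC pr arcs s {t} a m a w :=
  darc_of_orTailK_tail_coins pr hp hS h hm (hT.coreLevel_lsm pr hp) htC hts hws hwC

/-- **COROLLARY (out-tree core): both markers at the tail, arbitrary coins.** -/
theorem darc_of_orTailTreeK_tail₂_coins (pr : E → R) (hp : IsProbVec pr) (hS : SameEnds arcs)
    (h : OrTailK arcs s U ent c a) {c' : V → E} {par : V → V} {rk : V → ℕ}
    (hT : TreeCore arcs s U c' par rk)
    {t : V} (htC : t ∉ insert a U) (hts : t ≠ s) (hws : w ≠ s) (hwC : w ∉ insert a U) :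
    DARC pr arcs s {t} a a a w :=
  darc_of_orTailK_tail₂_coins pr hp hS h (hT.coreLevel_lsm pr hp) htC hts hws hwC

end TailCoins

end Summit.Ventures.PercRepro2.Coin
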